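import Summits.CriticalPhenomena.Ising3DConformalLimit.Theorems.InverseSquareTelemetryPositiveSolutionAsymptoticsAssembly
import Summits.CriticalPhenomena.Ising3DConformalLimit.Theorems.InverseSquareTelemetryPositiveSolutionAsymptoticsAprioriBounds
import Summits.CriticalPhenomena.Ising3DConformalLimit.Theorems.InverseSquareTelemetryPositiveSolutionAsymptoticsAnnulusSqueeze
import Literature.Probability.LatticeModels.EllipticHarnackConductances
import HarnessLib

/-!
# Crux `InverseSquareTelemetry.PositiveSolutionAsymptotics` (stmt-CriticalPhenomena-4496) — proved CONDITIONALLY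
# on the named fact `Literature.Probability.LatticeModels.conductanceHarnackZ3`

THEOREM-ONLY file (`--supports stmt-CriticalPhenomena-4496`; the item stays open until the fact is discharged).

Line `registered` (skeleton `Cruxes/PositiveSolutionAsymptotics/Lines/birth.lean`, lead
prover-line-stmt-CriticalPhenomena-4496-c2-0): the lattice Agmon–Murata–Pinchover asymptotics with exact
constant — every positive solution `u` of `Δ_{ℤ³}u = Vu` on `{|x|₂ ≥ R}` with `| |x|₂²V - κ | ≤ C|x|₂^{-ε}`
(`κ ≥ 0`) and `u → 0` has `u(x)|x|₂^{α₊} → c > 0` — is the composition (`of_bounds_blowDown_squeeze`, copied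
from the kernel-checked skeleton) of

* S1 `stub_aprioriBounds` (two-sided bounds, landed),
* S2 `stub_blowDownConstant` = `stub_blowDownOfHarnack hX` (landed: shell monotonicity T1, local harmonic
  comparison T3, annulus chains T4, Doob transform + Harnack chain), where `hX` is the elliptic Harnack
  inequality for uniformly elliptic conductances on `ℤ³` — the NAMED FACT `conductanceHarnackZ3`
  (Barlow 2017, Thm 7.19; not yet discharged in the tree),
* S3 `stub_annulusSqueeze` (finite two-annulus squeeze, landed).

`positiveSolutionAsymptotics_of_conductanceHarnackZ3 : conductanceHarnackZ3 → PositiveSolutionAsymptotics` is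
therefore a CONDITIONAL result with trust base `{conductanceHarnackZ3}`; landing
`theorem conductanceHarnackZ3_holds` closes the crux by `positiveSolutionAsymptotics_of_conductanceHarnackZ3
conductanceHarnackZ3_holds`.
-/

noncomputable section

namespace Summit.CriticalPhenomena.Ising3DConformalLimit.Theorems.PositiveSolutionAsymptotics

open Filter Topology

/-- **Composition S1 → S2 → S3 → crux** (the skeleton's `PositiveSolutionAsymptotics_of`, verbatim): `c ≥ m > 0`
from S1/S2; for `δ > 0` a good annulus at scale `ρ ≥ ρ₁(M + δ/3, δ/3)` (S2) and, for each far `x`, a second good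
annulus at scale `ρ' ≥ max(4ρ, |x|₂)` (S2 again); S3 squeezes `|q(x) - c| ≤ 2δ/3 < δ`. [folklore] -/
theorem of_bounds_blowDown_squeeze :
    (∀ κ ε C : ℝ, 0 ≤ κ → 0 < ε → ∀ (u V : Literature.Probability.LatticeModels.Site 3 → ℝ) (R : ℝ), (∀ x : Literature.Probability.LatticeModels.Site 3, R ≤ Real.sqrt (∑ i, ((x i : ℝ)) ^ 2) → 0 < u x) → (∀ x : Literature.Probability.LatticeModels.Site 3, R ≤ Real.sqrt (∑ i, ((x i : ℝ)) ^ 2) → (∑ i : Fin 3, (u (x + Pi.single i 1) + u (x - Pi.single i 1))) - 6 * u x = V x * u x) → (∀ x : Literature.Probability.LatticeModels.Site 3, R ≤ Real.sqrt (∑ i, ((x i : ℝ)) ^ 2) → |(∑ i, ((x i : ℝ)) ^ 2) * V x - κ| ≤ C * Real.sqrt (∑ i, ((x i : ℝ)) ^ 2) ^ (-ε)) → Filter.Tendsto u Filter.cofinite (nhds 0) → ∃ m M : ℝ, 0 < m ∧ ∀ᶠ x : Literature.Probability.LatticeModels.Site 3 in Filter.cofinite, m ≤ u x * Real.sqrt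 (∑ i, ((x i : ℝ)) ^ 2) ^ ((1 + Real.sqrt (1 + 4 * κ)) / 2) ∧ u x * Real.sqrt (∑ i, ((x i : ℝ)) ^ 2) ^ ((1 + Real.sqrt (1 + 4 * κ)) / 2) ≤ M) →
    (∀ κ ε C : ℝ, 0 ≤ κ → 0 < ε → ∀ (u V : Literature.Probability.LatticeModels.Site 3 → ℝ) (R : ℝ), (∀ x : Literature.Probability.LatticeModels.Site 3, R ≤ Real.sqrt (∑ i, ((x i : ℝ)) ^ 2) → 0 < u x) → (∀ x : Literature.Probability.LatticeModels.Site 3, R ≤ Real.sqrt (∑ i, ((x i : ℝ)) ^ 2) → (∑ i : Fin 3, (u (x + Pi.single i 1) + u (x - Pi.single i 1))) - 6 * u x = V x * u x) → (∀ x : Literature.Probability.LatticeModels.Site 3, R ≤ Real.sqrt (∑ i, ((x i : ℝ)) ^ 2) → |(∑ i, ((x i : ℝ)) ^ 2) * V x - κ| ≤ C * Real.sqrt (∑ i, ((x i : ℝ)) ^ 2) ^ (-ε)) → Filter.Tendsto u Filter.cofinite (nhds 0) → ∀ m M : ℝ, 0 < m → (∀ᶠ x : Literature.Probability.LatticeModels.Site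 3 in Filter.cofinite, m ≤ u x * Real.sqrt (∑ i, ((x i : ℝ)) ^ 2) ^ ((1 + Real.sqrt (1 + 4 * κ)) / 2) ∧ u x * Real.sqrt (∑ i, ((x i : ℝ)) ^ 2) ^ ((1 + Real.sqrt (1 + 4 * κ)) / 2) ≤ M) → ∃ c : ℝ, m ≤ c ∧ c ≤ M ∧ ∀ δ : ℝ, 0 < δ → ∀ ρ₀ : ℝ, ∃ ρ : ℝ, ρ₀ ≤ ρ ∧ ∀ x : Literature.Probability.LatticeModels.Site 3, ρ ≤ Real.sqrt (∑ i, ((x i : ℝ)) ^ 2) → Real.sqrt (∑ i, ((x i : ℝ)) ^ 2) ≤ 2 * ρ → |u x * Real.sqrt (∑ i, ((x i : ℝ)) ^ 2) ^ ((1 + Real.sqrt (1 + 4 * κ)) / 2) - c| ≤ δ) →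
    (∀ κ ε C : ℝ, 0 ≤ κ → 0 < ε → ∀ (u V : Literature.Probability.LatticeModels.Site 3 → ℝ) (R : ℝ), (∀ x : Literature.Probability.LatticeModels.Site 3, R ≤ Real.sqrt (∑ i, ((x i : ℝ)) ^ 2) → 0 < u x) → (∀ x : Literature.Probability.LatticeModels.Site 3, R ≤ Real.sqrt (∑ i, ((x i : ℝ)) ^ 2) → (∑ i : Fin 3, (u (x + Pi.single i 1) + u (x - Pi.single i 1))) - 6 * u x = V x * u x) → (∀ x : Literature.Probability.LatticeModels.Site 3, R ≤ Real.sqrt (∑ i, ((x i : ℝ)) ^ 2) → |(∑ i, ((x i : ℝ)) ^ 2) * V x - κ| ≤ C * Real.sqrt (∑ i, ((x i : ℝ)) ^ 2) ^ (-ε)) → ∀ B δ : ℝ, 0 < δ → ∃ ρ₁ : ℝ, ∀ ρ ρ' c₁ c₂ : ℝ, ρ₁ ≤ ρ → 4 * ρ ≤ ρ' → c₂ ≤ B → (∀ x : Literature.Probability.LatticeModels.Site 3, (ρ ≤ Real.sqrt (∑ i, ((x i : ℝ)) ^ 2) ∧ Real.sqrt (∑ i, ((x i : ℝ)) ^ 2)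 ≤ 2 * ρ) ∨ (ρ' ≤ Real.sqrt (∑ i, ((x i : ℝ)) ^ 2) ∧ Real.sqrt (∑ i, ((x i : ℝ)) ^ 2) ≤ 2 * ρ') → c₁ ≤ u x * Real.sqrt (∑ i, ((x i : ℝ)) ^ 2) ^ ((1 + Real.sqrt (1 + 4 * κ)) / 2) ∧ u x * Real.sqrt (∑ i, ((x i : ℝ)) ^ 2) ^ ((1 + Real.sqrt (1 + 4 * κ)) / 2) ≤ c₂) → ∀ x : Literature.Probability.LatticeModels.Site 3, 2 * ρ ≤ Real.sqrt (∑ i, ((x i : ℝ)) ^ 2) → Real.sqrt (∑ i, ((x i : ℝ)) ^ 2) ≤ ρ' → c₁ - δ ≤ u x * Real.sqrt (∑ i, ((x i : ℝ)) ^ 2) ^ ((1 + Real.sqrt (1 + 4 * κ)) / 2) ∧ u x * Real.sqrt (∑ i, ((x i : ℝ)) ^ 2) ^ ((1 + Real.sqrt (1 + 4 * κ)) / 2) ≤ c₂ + δ) →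
    Summit.CriticalPhenomena.Ising3DConformalLimit.Theses.InverseSquareTelemetry.PositiveSolutionAsymptotics := by
  intro h1 h2 h3 κ ε C hκ hε u V R hpos heq hV h0
  obtain ⟨m, M, hm, hbd⟩ := h1 κ ε C hκ hε u V R hpos heq hV h0
  obtain ⟨c, hmc, hcM, hwin⟩ := h2 κ ε C hκ hε u V R hpos heq hV h0 m M hm hbd
  have hsq := h3 κ ε C hκ hε u V R hpos heq hV
  refine ⟨c, lt_of_lt_of_le hm hmc, ?_⟩
  rw [Metric.tendsto_nhds]
  intro δ hδ
  have hδ3 : 0 < δ / 3 := by positivity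
  obtain ⟨ρ₁, hρ₁⟩ := hsq (M + δ / 3) (δ / 3) hδ3
  obtain ⟨ρ, hρ₁ρ, hρ⟩ := hwin (δ / 3) hδ3 ρ₁
  have hev : ∀ᶠ x : Literature.Probability.LatticeModels.Site 3 in Filter.cofinite, 2 * ρ ≤ Real.sqrt (∑ i, ((x i : ℝ)) ^ 2) :=
    (Real.tendsto_sqrt_atTop.comp
      Summit.CriticalPhenomena.Ising3DConformalLimit.Theorems.EtaBoundsFromTelemetry.tendsto_sumSq_cofinite).eventually_ge_atTop
      (2 * ρ)
  filter_upwards [hev] with x hx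
  obtain ⟨ρ', hρ'₀, hρ'⟩ := hwin (δ / 3) hδ3 (max (4 * ρ) (Real.sqrt (∑ i, ((x i : ℝ)) ^ 2)))
  have hann : ∀ y : Literature.Probability.LatticeModels.Site 3,
      (ρ ≤ Real.sqrt (∑ i, ((y i : ℝ)) ^ 2) ∧ Real.sqrt (∑ i, ((y i : ℝ)) ^ 2) ≤ 2 * ρ) ∨ (ρ' ≤ Real.sqrt (∑ i, ((y i : ℝ)) ^ 2) ∧ Real.sqrt (∑ i, ((y i : ℝ)) ^ 2) ≤ 2 * ρ') →
        c - δ / 3 ≤ u y * Real.sqrt (∑ i, ((y i : ℝ)) ^ 2) ^ ((1 + Real.sqrt (1 + 4 * κ)) / 2) ∧ u y * Real.sqrt (∑ i, ((y i : ℝ)) ^ 2) ^ ((1 + Real.sqrt (1 + 4 * κ)) / 2) ≤ c + δ / 3 := by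
    intro y hy
    rcases hy with ⟨hy1, hy2⟩ | ⟨hy1, hy2⟩
    · have hh := abs_le.1 (hρ y hy1 hy2)
      constructor <;> linarith [hh.1, hh.2]
    · have hh := abs_le.1 (hρ' y hy1 hy2)
      constructor <;> linarith [hh.1, hh.2]
  have key := hρ₁ ρ ρ' (c - δ / 3) (c + δ / 3) hρ₁ρ (le_trans (le_max_left _ _) hρ'₀)
    (by linarith) hann x hx (le_trans (le_max_right _ _) hρ'₀)
  rw [Real.dist_eq, abs_lt]
  constructor <;> linarith [key.1, key.2]


/-- **Crux `PositiveSolutionAsymptotics` (stmt-CriticalPhenomena-4496), conditional on the elliptic Harnack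
inequality for uniformly elliptic conductances on `ℤ³`** (`Literature.Probability.LatticeModels.conductanceHarnackZ3`,
Barlow 2017 Thm 7.19 — a named fact, the only undischarged input): S1 `stub_aprioriBounds`, S2
`stub_blowDownOfHarnack hX`, S3 `stub_annulusSqueeze`, composed by `of_bounds_blowDown_squeeze`. -/
theorem positiveSolutionAsymptotics_of_conductanceHarnackZ3 :
    Literature.Probability.LatticeModels.conductanceHarnackZ3 →
    Summit.CriticalPhenomena.Ising3DConformalLimit.Theses.InverseSquareTelemetry.PositiveSolutionAsymptotics :=
  fun hX => of_bounds_blowDown_squeeze stub_aprioriBounds (stub_blowDownOfHarnack hX) stub_annulusSqueeze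

end Summit.CriticalPhenomena.Ising3DConformalLimit.Theorems.PositiveSolutionAsymptotics
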